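import Literature.IUT.LogVolume.InitialThetaDataVolumeInhabited
import HarnessLib

/-!
# [IUTchI] Ex. 3.2 (iv), valuation half, at EVERY place of `K` over `𝕍(F)^bad`: `2l ∣ ord_w(q_E)` — no hypothesis
# (proof-only companion of `InitialThetaDataVolumeInhabited.lean`; the `K`-level idele side condition of branch C)

Mochizuki, *Inter-universal Teichmüller theory I*, RIMS manuscript (May 2020), Example 3.2 (iv) (kurims p. 71: "it
follows from our assumption concerning `2`-torsion [cf. Definition 3.1, (b)], together with the definition of `K` [cf.
Definition 3.1, (c)], that `q_v` admits a `2l`-th root in `𝒪^▷(T_{X̲̲_v}) (≅ 𝒪^▷_{K_v̲})`"), Definition 3.1 (b), (c)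
(kurims pp. 61–62). abc-iut cell, WAVE-5 prover seat abc-iut-w5-d009 (gen 7); CLAIM «R1-HK-DISCHARGE» (HOME/STATUS
2026-08-26T09:08:36Z) inside the C lead's ruling C-R16 (b) (repair R1 of FINDING C-cert-3-F1, p432420).

WHY. The branch-C certificates at abc-iut-c312-7's genuine real setting carry the idele side condition «the `q`-ideles
REALISE `P_q`», which over the completions of a number field `L` carrying pilot data `X : PilotData L` is satisfiable
iff `2l ∣ ord_w(q_w)` at every `w ∈ S` (abc-iut-c312-3 `exists_realising_qIdeles`, p420764, hypothesis
`hdiv : ∀ w ∈ X.S, (2·X.l : ℤ) ∣ X.ordq w`; converse `SideVacuity.two_mul_l_dvd_ordq_of_realising`, p432420). Over the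
field `F` of an initial Θ-datum this FAILS at every datum (Def. 3.1 (c): `l ∤ ord_v(q_v)`; p432420 / p432578), whence
the repair R1: pilot data over `K = F(E_F[l])` with `S_K :=` the places of `K` over `𝕍(F)^bad`. abc-iut-C-cert-3's plan
(STATUS 08:45:39Z) keeps the `K`-level divisibility as a named hypothesis FIELD `two_mul_l_dvd_ordq` ("derivable … only
via Tate-curve facts"); abc-iut-w5-d075's glue `PilotDataBaseChange.lean` (p433902) leaves exactly this input untouched.
THIS FILE PROVES IT for every collection of initial Θ-data, at EVERY place `w` of `K` over `𝕍(F)^bad` (not only at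
the section places `v̲ ∈ V̲^bad` of abc-iut-w5-d209's `ThetaData.two_mul_l_dvd_ordMinimalDiscriminant_liftPlace`), from
theorems already in the tree and nothing else:

* abc-iut-w5-d158's `WeierstrassCurve.two_mul_dvd_ordMinimalDiscriminant_baseChange_of_forall_smul_geomTorsion_eq`
  (`E/F` multiplicative at `v`, ANY `w ∣ v` in `K` with `w ∤ 2`, `w ∤ l`, `Γ_K` fixing `E_K[2]` and `E_K[l]` ⟹
  `2l ∣ ord_w(Δ_min(E_K))` — Silverman *ATAEC* V.6.1, classical, PROVED in tree);
* abc-iut-L5-t2's `InitialThetaData.smul_geomTorsion_two_eq` / `smul_geomTorsion_l_eq` (Def. 3.1 (b), (c) ⟹ `Γ_K`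
  fixes `E_K[2]`, `E_K[l]`) and `multiplicative_over_VbadMod` (Def. 3.1 (b));
* Def. 3.1 (b) "odd residue characteristic" and (c) "`l` prime to the elements of `V^bad_mod`" for `w ∤ 2`, `w ∤ l`;
* the tree's `log_valuation_j_eq_ordMinimalDiscriminant_of_hasMultiplicativeReductionAt` (Silverman AEC VII.5.1 (b))
  to pass from `Δ_min(E_K)` to `−ord_w(j_E)` = Dupuy–Hilado's `ord_w(q_w)` (c312-3's `PilotData.ordq`).

Results (namespace `Literature.IUT.LogVolume.ThetaData`, `D : InitialThetaData F K F̄ E l Pb`, `w` a finite place of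
`K` whose restriction to `F` lies in `𝕍(F)^bad`):
* `natCast_not_mem_of_not_residueChar_dvd`, `two_not_mem_of_under_mem_VFbad`, `l_not_mem_of_under_mem_VFbad` — `w ∤ 2`,
  `w ∤ l`;
* `hasMultiplicativeReductionAt_baseChange_of_under_mem_VFbad` — `E_F ×_F K` is multiplicative at `w`;
* **`two_mul_l_dvd_ordMinimalDiscriminant_of_under_mem_VFbad`** — `2l ∣ ord_w(Δ_min(E_F ×_F K))`;
* **`two_mul_l_dvd_neg_ord_j_of_under_mem_VFbad`** — `(2l : ℤ) ∣ −ord_w(j_E)` (`= ord_w(q_w)` of Dupuy–Hilado §3.3);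
* **`PilotData.hdiv_of_initialThetaData`** — for ANY pilot data `Y : PilotData K` with `Y.jE = j_E`, `Y.l = l` and
  `Y.S` consisting of places over `𝕍(F)^bad` (the shape of the `K`-level provenance of repair R1):
  `∀ w ∈ Y.S, (2·Y.l : ℤ) ∣ Y.ordq w` — VERBATIM the hypothesis `hdiv` of c312-3's `exists_realising_qIdeles` and the
  planned field `two_mul_l_dvd_ordq` of `IsPilotDataOfK`, now a theorem: at `K`-level pilot data of initial Θ-data
  REALISING `q`-ideles EXIST, so the side conditions of the `K`-level certificate (v5) are satisfiable with NO named
  hypothesis.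

PROOF-ONLY (0 `def`, 0 new `Prop`); the mathematics is classical (torsion and reduction of elliptic curves over local
fields); nothing here bears on [IUTchIII] Cor. 3.12, no side is taken on any author, and a statement about the cell's
TYPED objects is all that is claimed. [cite: Mochizuki2012, IUTchI Ex. 3.2 (iv) p. 71; Def. 3.1 (b)(c) pp. 61–62]
[cite: SilvermanATAEC1994, V.6 Prop. 6.1] [cite: DupuyHilado2025, §3.3, §3.4] [claim: Mochizuki2012, status: disputed]
for every IUT quotation.
-/

noncomputable section

open scoped Classical

namespace Literature.IUT.LogVolume

namespace ThetaData

open Literature.IUT.HodgeTheaters NumberField IsDedekindDomain WeierstrassCurve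

variable {F K Fbar : Type} [Field F] [NumberField F] [Field K] [NumberField K] [Algebra F K]
  [Field Fbar] [Algebra F Fbar] [Algebra K Fbar] {E : WeierstrassCurve F} [E.IsElliptic] {l : ℕ}
  {Pb : BadPlacePredicates K} (D : InitialThetaData F K Fbar E l Pb)

/-! ## Places of `K` over `𝕍(F)^bad`: `w ∤ 2`, `w ∤ l` -/

omit [NumberField F] [NumberField K] in
/-- The place of `F` below `w` lies below `w` (Mathlib `LiesOver`, by definition of `under`). [folklore] -/
private theorem liesOver_under (w : HeightOneSpectrum (𝓞 K)) :
    w.asIdeal.LiesOver (w.under (𝓞 F)).asIdeal := ⟨rfl⟩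

/-- A place `w` of `K` whose restriction `w ∩ 𝓞_F` lies in `𝕍(F)^bad` lies over a bad prime of `F_mod`: the prime
of `𝓞_{F_mod}` below `w` is in `V^bad_mod` (S2's `mk_mem_VFbad_iff`). [claim: Mochizuki2012, status: disputed] -/
theorem under_under_mem_badPrimesMod {w : HeightOneSpectrum (𝓞 K)}
    (hw : FinitePlace.mk (w.under (𝓞 F)) ∈ D.VFbad) :
    (w.under (𝓞 F)).under (𝓞 (fieldOfModuli E)) ∈ badPrimesMod D :=
  (mk_mem_VFbad_iff D (w.under (𝓞 F))).mp hw

omit [NumberField K] in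
/-- A natural number prime to the residue characteristic of the prime of `F_mod` below a place `w` of `K` does not
lie in `w` (`w ∩ 𝓞_{F_mod}` is that prime; Neukirch ANT I §8, primes in extensions). [cite: NeukirchANT1999, Ch. I §8] -/
theorem natCast_not_mem_of_not_residueChar_dvd (w : HeightOneSpectrum (𝓞 K)) {n : ℕ}
    (hn : ¬ Literature.IUT.HodgeTheaters.residueChar
      (FinitePlace.mk ((w.under (𝓞 F)).under (𝓞 (fieldOfModuli E)))) ∣ n) :
    ((n : ℕ) : 𝓞 K) ∉ w.asIdeal := by
  intro hmem
  apply hn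
  set u := (w.under (𝓞 F)).under (𝓞 (fieldOfModuli E)) with hu
  -- pull back to `u = w ∩ 𝓞_{F_mod}`: `(n : 𝓞_{F_mod}) ∈ u`
  have hv : ((n : ℕ) : 𝓞 (fieldOfModuli E)) ∈ u.asIdeal := by
    rw [hu, HeightOneSpectrum.under_asIdeal, HeightOneSpectrum.under_asIdeal, Ideal.under_under]
    refine Ideal.mem_comap.mpr ?_
    rwa [map_natCast]
  -- hence `n = 0` in the residue ring of `u`, whose characteristic is the residue characteristic
  have h0 : ((n : ℕ) : 𝓞 (fieldOfModuli E) ⧸ u.asIdeal) = 0 := by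
    rw [← map_natCast (Ideal.Quotient.mk u.asIdeal), Ideal.Quotient.eq_zero_iff_mem]
    exact hv
  have hchar := (ringChar.spec (𝓞 (fieldOfModuli E) ⧸ u.asIdeal) n).mp h0
  unfold Literature.IUT.HodgeTheaters.residueChar
  rwa [FinitePlace.maximalIdeal_mk]

/-- The residue ring `𝓞_{F_mod}/u` has characteristic `≠ 1`. [folklore] -/
private theorem residueChar_mk_ne_one' (u : HeightOneSpectrum (𝓞 (fieldOfModuli E))) :
    Literature.IUT.HodgeTheaters.residueChar (FinitePlace.mk u) ≠ 1 := by
  unfold Literature.IUT.HodgeTheaters.residueChar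
  rw [FinitePlace.maximalIdeal_mk]
  haveI : Nontrivial (𝓞 (fieldOfModuli E) ⧸ u.asIdeal) := Ideal.Quotient.nontrivial_iff.mpr u.isPrime.ne_top
  exact CharP.ringChar_ne_one

/-- **`w ∤ 2`** for every place `w` of `K` over `𝕍(F)^bad` (Def. 3.1 (b): "`V^bad_mod` … of odd residue
characteristic"). [claim: Mochizuki2012, status: disputed] -/
theorem two_not_mem_of_under_mem_VFbad {w : HeightOneSpectrum (𝓞 K)}
    (hw : FinitePlace.mk (w.under (𝓞 F)) ∈ D.VFbad) : (2 : 𝓞 K) ∉ w.asIdeal := by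
  have hbad := under_under_mem_badPrimesMod D hw
  set u := (w.under (𝓞 F)).under (𝓞 (fieldOfModuli E)) with hu
  have h := natCast_not_mem_of_not_residueChar_dvd (E := E) w (n := 2) (by
    intro hd
    have hodd := D.VbadMod_odd (FinitePlace.mk u) ((mem_badPrimesMod_iff D u).mp hbad)
    rcases (Nat.dvd_prime Nat.prime_two).mp hd with h1 | h2
    · exact residueChar_mk_ne_one' u h1
    · rw [h2] at hodd
      exact (Nat.not_odd_iff_even.mpr even_two) hodd)
  exact_mod_cast h

/-- **`w ∤ l`** for every place `w` of `K` over `𝕍(F)^bad` (Def. 3.1 (c): "`l` is prime to the elements of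
`V^bad_mod`"). [claim: Mochizuki2012, status: disputed] -/
theorem l_not_mem_of_under_mem_VFbad {w : HeightOneSpectrum (𝓞 K)}
    (hw : FinitePlace.mk (w.under (𝓞 F)) ∈ D.VFbad) : (l : 𝓞 K) ∉ w.asIdeal := by
  have hbad := under_under_mem_badPrimesMod D hw
  set u := (w.under (𝓞 F)).under (𝓞 (fieldOfModuli E)) with hu
  exact natCast_not_mem_of_not_residueChar_dvd (E := E) w (n := l) (by
    intro hd
    have hne := D.l_ne_residueChar (FinitePlace.mk u) ((mem_badPrimesMod_iff D u).mp hbad)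
    rcases (Nat.dvd_prime D.l_prime).mp hd with h1 | h2
    · exact residueChar_mk_ne_one' u h1
    · exact hne h2)

/-! ## Multiplicative reduction of `E_F ×_F K` and `2l ∣ ord_w(Δ_min)` at every `w` over `𝕍(F)^bad` -/

/-- `E_F` has multiplicative reduction at the place of `F` below `w` (Def. 3.1 (b) "`X_F` has bad [i.e.,
multiplicative] reduction at the elements of `V(F)` that lie over `V^bad_mod`"). [claim: Mochizuki2012, status: disputed] -/
theorem hasMultiplicativeReductionAt_under_of_mem_VFbad {w : HeightOneSpectrum (𝓞 K)}
    (hw : FinitePlace.mk (w.under (𝓞 F)) ∈ D.VFbad) : E.HasMultiplicativeReductionAt (w.under (𝓞 F)) := by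
  have h := D.multiplicative_over_VbadMod (FinitePlace.mk (w.under (𝓞 F))) hw
  rwa [FinitePlace.maximalIdeal_mk] at h

/-- **`E_F ×_F K` has multiplicative reduction at every place `w` of `K` over `𝕍(F)^bad`**: multiplicative
reduction below (Def. 3.1 (b)) survives the base change because `Γ_K` fixes `E_K[l]`, `l ≥ 5`, `w ∤ l`
(abc-iut-w5-d158 / [IUTchIV] Prop. 1.8 (v)). [claim: Mochizuki2012, status: disputed] -/
theorem hasMultiplicativeReductionAt_baseChange_of_under_mem_VFbad {w : HeightOneSpectrum (𝓞 K)}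
    (hw : FinitePlace.mk (w.under (𝓞 F)) ∈ D.VFbad) : (E.baseChange K).HasMultiplicativeReductionAt w := by
  haveI := liesOver_under (F := F) w
  have hl3 : 3 ≤ l := by have := D.five_le_l; omega
  exact E.hasMultiplicativeReductionAt_baseChange_of_forall_smul_geomTorsion_eq
    (hasMultiplicativeReductionAt_under_of_mem_VFbad D hw) D.l_prime hl3 (l_not_mem_of_under_mem_VFbad D hw)
    (D.smul_geomTorsion_l_eq)

/-- **[IUTchI] Ex. 3.2 (iv), valuation half, at EVERY place over `𝕍(F)^bad`: `2l ∣ ord_w(Δ_min(E_F ×_F K))`**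
(`= ord_w(q_w)`) — abc-iut-w5-d158's `two_mul_dvd_ordMinimalDiscriminant_baseChange_of_forall_smul_geomTorsion_eq`
with L5-t2's Galois bridge and `w ∤ 2`, `w ∤ l`. No residual hypothesis; `w` need NOT be the section place `v̲`.
[claim: Mochizuki2012, status: disputed] -/
theorem two_mul_l_dvd_ordMinimalDiscriminant_of_under_mem_VFbad {w : HeightOneSpectrum (𝓞 K)}
    (hw : FinitePlace.mk (w.under (𝓞 F)) ∈ D.VFbad) : 2 * l ∣ (E.baseChange K).ordMinimalDiscriminant w := by
  haveI := liesOver_under (F := F) w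
  have hl2 : l ≠ 2 := by have := D.five_le_l; omega
  exact E.two_mul_dvd_ordMinimalDiscriminant_baseChange_of_forall_smul_geomTorsion_eq
    (hasMultiplicativeReductionAt_under_of_mem_VFbad D hw) D.l_prime hl2 (two_not_mem_of_under_mem_VFbad D hw)
    (l_not_mem_of_under_mem_VFbad D hw) (D.smul_geomTorsion_two_eq) (D.smul_geomTorsion_l_eq)

/-- **`−ord_w(j_E) = ord_w(Δ_min(E_F ×_F K))`** at every place `w` of `K` over `𝕍(F)^bad` (Silverman AEC VII.5.1 (b)
at the multiplicative place `w`; the tree's `log_valuation_j_eq_ordMinimalDiscriminant_of_hasMultiplicativeReductionAt`,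
`ord = −log ∘ valuation`). The left side is Dupuy–Hilado's `ord_w(q_w)` for pilot data with `j`-invariant `j_E`
(c312-3's `PilotData.ordq`). [cite: DupuyHilado2025, §3.3] -/
theorem neg_ord_j_eq_ordMinimalDiscriminant_of_under_mem_VFbad {w : HeightOneSpectrum (𝓞 K)}
    (hw : FinitePlace.mk (w.under (𝓞 F)) ∈ D.VFbad) :
    -ord K w (algebraMap F K E.j) = ((E.baseChange K).ordMinimalDiscriminant w : ℤ) := by
  haveI : (E.baseChange K).IsElliptic := inferInstanceAs (E.map (algebraMap F K)).IsElliptic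
  rw [← (E.baseChange K).log_valuation_j_eq_ordMinimalDiscriminant_of_hasMultiplicativeReductionAt w
    (hasMultiplicativeReductionAt_baseChange_of_under_mem_VFbad D hw),
    show (E.baseChange K).j = algebraMap F K E.j from E.map_j _]
  unfold ord
  ring

/-- **`(2l : ℤ) ∣ −ord_w(j_E)`** — i.e. `2l ∣ ord_w(q_w)` in Dupuy–Hilado's normalisation — at EVERY place `w` of
`K = F(E_F[l])` over `𝕍(F)^bad`, for every collection of initial Θ-data. [cite: Mochizuki2012, IUTchI Ex. 3.2 (iv) p. 71] -/
theorem two_mul_l_dvd_neg_ord_j_of_under_mem_VFbad {w : HeightOneSpectrum (𝓞 K)}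
    (hw : FinitePlace.mk (w.under (𝓞 F)) ∈ D.VFbad) :
    (2 * (l : ℤ)) ∣ -ord K w (algebraMap F K E.j) := by
  rw [neg_ord_j_eq_ordMinimalDiscriminant_of_under_mem_VFbad D hw]
  exact_mod_cast two_mul_l_dvd_ordMinimalDiscriminant_of_under_mem_VFbad D hw

/-- The same divisibility with `2l` read as a natural-number cast `((2l : ℕ) : ℤ)`.
[cite: Mochizuki2012, IUTchI Ex. 3.2 (iv) p. 71] -/
theorem natCast_two_mul_l_dvd_neg_ord_j_of_under_mem_VFbad {w : HeightOneSpectrum (𝓞 K)}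
    (hw : FinitePlace.mk (w.under (𝓞 F)) ∈ D.VFbad) :
    ((2 * l : ℕ) : ℤ) ∣ -ord K w (algebraMap F K E.j) := by
  push_cast
  exact two_mul_l_dvd_neg_ord_j_of_under_mem_VFbad D hw

end ThetaData

/-! ## The `K`-level pilot data of repair R1: the hypothesis `hdiv` of `exists_realising_qIdeles` is a THEOREM -/

namespace PilotData

open Literature.IUT.HodgeTheaters NumberField IsDedekindDomain WeierstrassCurve

variable {F K Fbar : Type} [Field F] [NumberField F] [Field K] [NumberField K] [Algebra F K]
  [Field Fbar] [Algebra F Fbar] [Algebra K Fbar] {E : WeierstrassCurve F} [E.IsElliptic] {l : ℕ}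
  {Pb : BadPlacePredicates K} (D : InitialThetaData F K Fbar E l Pb)

/-- **Realising `q`-ideles EXIST at `K`-level pilot data of initial Θ-data — the divisibility input.** Let
`Y : PilotData K` be ANY Dupuy–Hilado pilot data over `K` attached to the initial Θ-data `D` in the sense of the
branch-C repair R1 (abc-iut-plan C-R16 (b)): its `j`-invariant is `j_E` (`hj`), its prime is `l` (`hl`), and its bad
set consists of places of `K` over `𝕍(F)^bad` (`hS`; e.g. ALL of them). Then `∀ w ∈ Y.S, (2·Y.l : ℤ) ∣ Y.ordq w` —
VERBATIM the hypothesis `hdiv` of abc-iut-c312-3's `Thm311.Real.exists_realising_qIdeles` (p420764) and the planned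
field `two_mul_l_dvd_ordq` of abc-iut-C-cert-3's `IsPilotDataOfK`. Hence the idele side conditions `htq0 ∧ htq1 ∧ htq`
of the `K`-level certificate are SATISFIABLE at every genuine datum with no named hypothesis (contrast: over `F` they
are unsatisfiable at every datum, `SideVacuity.sideConditions_unsat_of_isPilotDataOf`, p432420).
[cite: Mochizuki2012, IUTchI Ex. 3.2 (iv) p. 71] [cite: DupuyHilado2025, §3.3, §3.4] -/
theorem hdiv_of_initialThetaData (Y : PilotData K) (hj : Y.jE = algebraMap F K E.j) (hl : Y.l = l)
    (hS : ∀ w ∈ Y.S, FinitePlace.mk (w.under (𝓞 F)) ∈ D.VFbad) :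
    ∀ w ∈ Y.S, (2 * Y.l : ℤ) ∣ Y.ordq w := by
  intro w hw
  rw [hl]
  unfold PilotData.ordq
  rw [hj]
  exact ThetaData.two_mul_l_dvd_neg_ord_j_of_under_mem_VFbad D (hS w hw)

/-- The Θ-side twin: `(2·Y.l : ℤ) ∣ Y.ordq w` is also the divisibility behind REALISING Θ-ideles
(`P_{Θ,j} = j²·P_q`; c312-3's `exists_realising_thetaIdeles` takes the same `hdiv`), restated with the coefficient
`j²` made explicit: `(2·Y.l : ℤ) ∣ j²·Y.ordq w`. [cite: DupuyHilado2025, §3.3] -/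
theorem sq_mul_hdiv_of_initialThetaData (Y : PilotData K) (hj : Y.jE = algebraMap F K E.j) (hl : Y.l = l)
    (hS : ∀ w ∈ Y.S, FinitePlace.mk (w.under (𝓞 F)) ∈ D.VFbad) (j : ℤ) :
    ∀ w ∈ Y.S, (2 * Y.l : ℤ) ∣ j ^ 2 * Y.ordq w :=
  fun w hw => (hdiv_of_initialThetaData D Y hj hl hS w hw).mul_left _

end PilotData

end Literature.IUT.LogVolume

end
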